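import Summits.HodgeConjecture.HodgeCM.Model.EndStateMeet_1

/-! PORT of `HodgeCM/Model/EndStateMeet.lean` (HodgeCMPerL run 82) — part 2: continuation of `Summits.HodgeConjecture.HodgeCM.Model.EndStateMeet_1` (split at a top-level declaration boundary by port_pkg.py; scope re-opened below; declarations unchanged). -/

-- port_pkg: scope re-opened for this part (file-level context, then the namespace/section stack open at the cut)
noncomputable section
open scoped TensorProduct InnerProductSpace Matrix
namespace HodgeCM
open Literature.AlgebraicGeometry.Motives (CMType HodgeStructure)
open Literature.AlgebraicGeometry.Motives.HodgeStructure (conj)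
open HodgeCM.Prior.Perl34File
namespace Universe
variable (U : Universe)
variable {U}
namespace ModelAxiomsPerL
/-- **Pointwise construction of the meeting realisation** at `(V, c)` from the six input bodies (general `T`, with the
`chars` bodies `h₉`; `h₇` in the `S₁₂`-form). -/
theorem nonempty_thetaRealisation₂_at (M : U.ModelAxiomsPerL) (T : U.ThetaModel) (hHR : U.Fact_hodgeRiemann20)
    {L : CMField} {ι₁ : L →+* ℂ} (V : HermSpace3 L ι₁) (c : SeesawCtx L) (h₂ : T.InnerEmbAt V)
    (h₅ : ∀ (i : Fin 4) (Γ : Level V), T.Theta V c i Γ ⊆ U.Uiso Γ c.K (c.Ψ i) c.σ)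
    (h₆ : ∃ Γ : Level V, ∃ ω₁ ∈ T.Theta V c 0 Γ, ∃ ω₂ ∈ T.Theta V c 1 Γ, U.cup2C (U.pms L ι₁ V Γ) 1 ω₁ ω₂ ≠ 0)
    (h₇ : ∀ (Γ : Level V) (ω₁ ω₂ : U.CohC (U.pms L ι₁ V Γ) 1), ω₁ ∈ T.Theta V c 0 Γ → ω₂ ∈ T.Theta V c 1 Γ →
      T.Λ Γ ω₁ ω₂ ≠ 0 → ∃ u ∈ (T.t12 V c).S12, ⟪T.Λ Γ ω₁ ω₂, u⟫_ℂ ≠ 0)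
    (h₈ : ∀ χ : (T.t34 V c).X, (T.t34 V c).allowed χ → ∀ (Φ : T.SK V c) (Γ₁ : Level V)
      (ω₁ ω₂ : U.CohC (U.pms L ι₁ V Γ₁) 1), ω₁ ∈ U.Uiso Γ₁ c.K (c.Ψ 0) c.σ → ω₂ ∈ U.Uiso Γ₁ c.K (c.Ψ 1) c.σ →
      ⟪T.Λ Γ₁ ω₁ ω₂, (T.t34 V c).ϑ χ Φ⟫_ℂ ≠ 0 →
      ∃ (Γ : Level V) (ω : Fin 4 → U.CohC (U.pms L ι₁ V Γ) 1),
        (∀ i, ω i ∈ U.Uiso Γ c.K (c.Ψ i) c.σ) ∧ ⟪T.Λ Γ (ω 2) (ω 3), T.Λ Γ (ω 0) (ω 1)⟫_ℂ ≠ 0)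
    (h₉ : (∀ χ : (T.t12 V c).X, (T.t12 V c).allowed χ) ∧ (∀ χ : (T.t34 V c).X, (T.t34 V c).allowed χ))
    (h₁₀ : (∀ (Φ : T.SK V c) (i : T.SigIdx V c),
        (∃ v ∈ (T.core V c).hatσ i, (T.core V c).TΦ Φ v ≠ 0) → (T.t12 V c).wOccurs i) ∧
      (∀ (Φ : T.SK V c) (i : T.SigIdx V c),
        (∃ v ∈ (T.core V c).hatσ i, (T.core V c).TΦ Φ v ≠ 0) → (T.t34 V c).wOccurs i)) :
    Nonempty (U.ThetaRealisation₂ ι₁ V c.K c.Ψ c.σ) := by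
  have hH10 : ∀ (i : Fin 4) (Γ : Level V), ∀ ω ∈ T.Theta V c i Γ, ω ∈ U.H10 (U.pms L ι₁ V Γ) :=
    fun i Γ ω hω => U.Uiso_le_H10 M.pull_hodge Γ c.K (c.Ψ i) c.σ (h₅ i Γ hω)
  refine ⟨{
    H := T.H V c
    HG := T.HG L ι₁ V
    CG := T.CG V c
    G := T.G V c
    SK := T.SK V c
    SigIdx := T.SigIdx V c
    SigIdxG := T.SigIdxG V c
    S := { core := T.core V c, t12 := T.t12 V c, t34 := T.t34 V c
           H_chars12 := h₉.1, H_chars34 := h₉.2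
           H_occ12 := h₁₀.1, H_occ34 := h₁₀.2 }
    Λ := fun Γ => T.Λ Γ
    Theta := fun i Γ => T.Theta V c i Γ
    Theta_sub := fun i Γ => h₅ i Γ
    lineField := ?_
    gen12Meet := fun Γ ω₁ ω₂ e₁ e₂ hne => h₇ Γ ω₁ ω₂ e₁ e₂ hne
    real34Meet := fun χ hχ Φ Γ₁ ω₁ ω₂ e₁ e₂ hne => h₈ χ hχ Φ Γ₁ ω₁ ω₂ e₁ e₂ hne
    inner_Λ := ?_ }⟩
  · -- Prop 4.3 on forms ⇒ on L² functions (Hodge–Riemann)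
    obtain ⟨Γ, ω₁, e₁, ω₂, e₂, hne⟩ := h₆
    exact ⟨Γ, ω₁, e₁, ω₂, e₂,
      emb_ne_zero_at M T Γ (h₂ Γ) hHR (cup2C_mem_F2 M _ (hH10 0 Γ ω₁ e₁) (hH10 1 Γ ω₂ e₂)) hne⟩
  · -- Petersson = period
    intro Γ
    obtain ⟨c₀, hc₀, h⟩ := h₂ Γ
    refine ⟨c₀, hc₀, fun ω hω => ?_⟩
    show ⟪T.emb Γ (U.cup2C _ 1 (ω 2) (ω 3)), T.emb Γ (U.cup2C _ 1 (ω 0) (ω 1))⟫_ℂ = c₀ * U.period _ ω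
    rw [h _ _ (cup2C_mem_F2 M _ (hω 0) (hω 1)) (cup2C_mem_F2 M _ (hω 2) (hω 3)), conj_cup2C _ 1]
    rfl

/-- **Pointwise construction, all-characters form** (no `chars` hypothesis; `h₇` in the generator form
`Gen12MeetAt`, `h₈ = Real34MeetAt`): the realisation is built for `T.allChars` at `(V, c)` (`TorusData.allChars_S12`;
all other data of `T.allChars` are those of `T` by `rfl`). -/
theorem nonempty_thetaRealisation₂_at_allChars (M : U.ModelAxiomsPerL) (T : U.ThetaModel)
    (hHR : U.Fact_hodgeRiemann20) {L : CMField} {ι₁ : L →+* ℂ} (V : HermSpace3 L ι₁) (c : SeesawCtx L)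
    (h₂ : T.InnerEmbAt V) (h₅ : ∀ (i : Fin 4) (Γ : Level V), T.Theta V c i Γ ⊆ U.Uiso Γ c.K (c.Ψ i) c.σ)
    (h₆ : ∃ Γ : Level V, ∃ ω₁ ∈ T.Theta V c 0 Γ, ∃ ω₂ ∈ T.Theta V c 1 Γ, U.cup2C (U.pms L ι₁ V Γ) 1 ω₁ ω₂ ≠ 0)
    (h₇ : T.Gen12MeetAt V c) (h₈ : T.Real34MeetAt V c)
    (h₁₀ : (∀ (Φ : T.SK V c) (i : T.SigIdx V c),
        (∃ v ∈ (T.core V c).hatσ i, (T.core V c).TΦ Φ v ≠ 0) → (T.t12 V c).wOccurs i) ∧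
      (∀ (Φ : T.SK V c) (i : T.SigIdx V c),
        (∃ v ∈ (T.core V c).hatσ i, (T.core V c).TΦ Φ v ≠ 0) → (T.t34 V c).wOccurs i)) :
    Nonempty (U.ThetaRealisation₂ ι₁ V c.K c.Ψ c.σ) :=
  nonempty_thetaRealisation₂_at M T.allChars hHR V c h₂ h₅ h₆
    (fun Γ ω₁ ω₂ e₁ e₂ hne => by
      obtain ⟨χ, Φ, h⟩ := h₇ Γ ω₁ ω₂ e₁ e₂ hne
      refine ⟨(T.t12 V c).ϑ χ Φ, ?_, h⟩
      show (T.t12 V c).ϑ χ Φ ∈ ((T.t12 V c).allChars).S12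
      rw [Prior.Perl34File.Perl34.TorusData.allChars_S12]
      exact Submodule.le_topologicalClosure _ (Submodule.subset_span ⟨χ, Φ, rfl⟩))
    (fun χ _ Φ => h₈ χ Φ) ⟨fun _ => trivial, fun _ => trivial⟩ h₁₀

/-- **`RealisationExistsPerL₂` from the pointwise meeting record on any class `S` containing the SEXTIC contexts**
(+ the facts, the two design constraints, Hodge–Riemann; NO `chars` input): as `realisationExistsPerL₁_of_pt`. -/
theorem realisationExistsPerL₂_of_pt (M : U.ModelAxiomsPerL) (T : U.ThetaModel) (hHR : U.Fact_hodgeRiemann20)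
    (hκ : T.Design_kappaConj) (hs : T.Design_frameSignConj) {S : ∀ {L : CMField}, SeesawCtx L → Prop}
    (hS : ∀ {L : CMField} (c : SeesawCtx L), Module.finrank ℚ c.K = 6 → S c) (A : T.AllCharsNonDesignPt₂ S) :
    U.RealisationExistsPerL₂ := by
  intro K L j _ hK _ φ hφ ι₁ hι₁ t ht V
  have hmem : ∀ i, φ 0 ∈ (t i).1 := fun i => (ht i 0).mpr (by fin_cases i <;> rfl)
  have hΨ : PairSum t := StubTree.pairSum_of_isPerLTypes K φ hφ hK t ht
  obtain ⟨D, hD⟩ := T.exists_seesawDatum_constructed hκ hs j ι₁ t hΨ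
  let c : SeesawCtx L := ⟨K, t, φ 0, D⟩
  have hc : T.GoodCtx ι₁ c := ⟨hΨ, StubTree.injective_of_isPerLTypes K φ hφ t ht, hmem, ⟨j, hι₁, hD⟩⟩
  have hSc : S c := hS c hK
  exact nonempty_thetaRealisation₂_at_allChars M T hHR V c (A.innerEmb V c hc hSc) (A.thetaSub V c hc hSc)
    (A.thetaWedge V c hc hSc) (A.gen12Meet V c hc hSc) (A.real34Meet V c hc hSc) (A.occ V c hc hSc)

/-- **PerL from the pointwise meeting record** on any class containing the sextic contexts. -/
theorem perL_of_pt₂ (M : U.ModelAxiomsPerL) (T : U.ThetaModel) (hHR : U.Fact_hodgeRiemann20)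
    (hκ : T.Design_kappaConj) (hs : T.Design_frameSignConj) {S : ∀ {L : CMField}, SeesawCtx L → Prop}
    (hS : ∀ {L : CMField} (c : SeesawCtx L), Module.finrank ℚ c.K = 6 → S c) (A : T.AllCharsNonDesignPt₂ S) :
    U.PerL :=
  perL₂ M (realisationExistsPerL₂_of_pt M T hHR hκ hs hS A)

/-- E3's `perL_of_pt₁` is the case `A.toMeet₂`. -/
example (M : U.ModelAxiomsPerL) (T : U.ThetaModel) (hHR : U.Fact_hodgeRiemann20)
    (hκ : T.Design_kappaConj) (hs : T.Design_frameSignConj) {S : ∀ {L : CMField}, SeesawCtx L → Prop}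
    (hS : ∀ {L : CMField} (c : SeesawCtx L), Module.finrank ℚ c.K = 6 → S c) (A : T.AllCharsNonDesignPt₁ S) :
    U.PerL :=
  perL_of_pt₂ M T hHR hκ hs hS A.toMeet₂

end ModelAxiomsPerL

/-! ### The typed hypotheses, meeting form -/

variable (U) in
/-- **"A theta model exists", pointwise MEETING form on the class `S`**: a convention bit, a core datum
`C = (emb, cover, wm, Theta)`, per context the two side data, and the six inputs of `AllCharsNonDesignPt₂ S`. -/
def ThetaModelExistsPt₂ (S : ∀ {L : CMField}, SeesawCtx L → Prop) : Prop :=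
  ∃ (h : Bool) (C : U.AdelicThetaCore₀) (d12 d34 : ∀ {L : CMField}, SeesawCtx L → SideData L),
    (C.thetaModel h d12 d34).AllCharsNonDesignPt₂ S

variable (U) in
/-- **The SEXTIC-restricted meeting hypothesis** — what the model-construction sub-cell has to produce for `W_per^L`:
the six inputs at good contexts with SEXTIC type field only, each at the `V` at hand. -/
def ThetaModelExists_sextic₂ : Prop :=
  U.ThetaModelExistsPt₂ (fun c => Module.finrank ℚ c.K = 6)

/-- (Ported verbatim from the HodgeCMPerL package; no docstring in the source.) -/
theorem ThetaModelExistsPt₁.toMeet₂ {S : ∀ {L : CMField}, SeesawCtx L → Prop} (H : U.ThetaModelExistsPt₁ S) :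
    U.ThetaModelExistsPt₂ S := by
  obtain ⟨h, C, d12, d34, A⟩ := H
  exact ⟨h, C, d12, d34, A.toMeet₂⟩

/-- (Ported verbatim from the HodgeCMPerL package; no docstring in the source.) -/
theorem ThetaModelExists_sextic₁.toMeet₂ (H : U.ThetaModelExists_sextic₁) : U.ThetaModelExists_sextic₂ :=
  ThetaModelExistsPt₁.toMeet₂ H

end Universe

/-! ## 5. E4 — the END STATE, meeting form (pointwise; the one for the geometric model) -/

namespace Assembly

open HodgeCM.Universe (AdelicThetaCore₀ SideData ThetaModel ModelAxiomsPerL)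

variable (U : Universe)

/-- **E4, POINTWISE: PerL over the FIVE model facts from the SIX inputs {C2, C3, C4, C5′, C6′, C7} demanded only at
good SEXTIC-type contexts (class `S ⊇ sextic`) and at the hermitian space at hand — no level-change input, the two
closure-span inputs replaced by the non-orthogonality statements Thm 4.4 consumes.**  This is the term the E seat
instantiates for the geometric model. -/
theorem perL_ofSignRecipe₁₀ (M : U.ModelAxiomsPerL) (h : Bool) (C : U.AdelicThetaCore₀)
    (d12 d34 : ∀ {L : CMField}, SeesawCtx L → SideData L) {S : ∀ {L : CMField}, SeesawCtx L → Prop}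
    (hS : ∀ {L : CMField} (c : SeesawCtx L), Module.finrank ℚ c.K = 6 → S c)
    (A : (C.thetaModel h d12 d34).AllCharsNonDesignPt₂ S) (hHR : U.Fact_hodgeRiemann20) : U.PerL :=
  M.perL_of_pt₂ (C.thetaModel h d12 d34) hHR (C.design_kappaConj h d12 d34) (C.design_frameSignConj h d12 d34) hS A

/-- **PerL from the sextic meeting hypothesis** (the `∃`-packaged form of ₁₀). -/
theorem perL_of_thetaModelExists_sextic₂ (M : U.ModelAxiomsPerL) (hHR : U.Fact_hodgeRiemann20)
    (H : U.ThetaModelExists_sextic₂) : U.PerL := by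
  obtain ⟨h, C, d12, d34, A⟩ := H
  exact perL_ofSignRecipe₁₀ U M h C d12 d34 (fun _ hK => hK) A hHR

/-- E3's pointwise end state ₉ (hence ₈, E2″ = ₇'', E2′ = ₇', E2 = ₇) is the case `A.toMeet₂` of ₁₀. -/
example (M : U.ModelAxiomsPerL) (h : Bool) (C : U.AdelicThetaCore₀)
    (d12 d34 : ∀ {L : CMField}, SeesawCtx L → SideData L) {S : ∀ {L : CMField}, SeesawCtx L → Prop}
    (hS : ∀ {L : CMField} (c : SeesawCtx L), Module.finrank ℚ c.K = 6 → S c)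
    (A : (C.thetaModel h d12 d34).AllCharsNonDesignPt₁ S) (hHR : U.Fact_hodgeRiemann20) : U.PerL :=
  perL_ofSignRecipe₁₀ U M h C d12 d34 hS A.toMeet₂ hHR

example (M : U.ModelAxiomsPerL) (h : Bool) (C : U.AdelicThetaCore₀)
    (d12 d34 : ∀ {L : CMField}, SeesawCtx L → SideData L) {S : ∀ {L : CMField}, SeesawCtx L → Prop}
    (hS : ∀ {L : CMField} (c : SeesawCtx L), Module.finrank ℚ c.K = 6 → S c)
    (A : (C.thetaModel h d12 d34).AllCharsNonDesignPt S) (hHR : U.Fact_hodgeRiemann20) : U.PerL :=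
  perL_ofSignRecipe₁₀ U M h C d12 d34 hS (A.toMeet₂ M.pull_comp M.pull_cup) hHR

example (M : U.ModelAxioms) (h : Bool) (C : U.AdelicThetaCore₀)
    (d12 d34 : ∀ {L : CMField}, SeesawCtx L → SideData L)
    (A : (C.thetaModel h d12 d34).AllCharsNonDesign) (hHR : U.Fact_hodgeRiemann20) : U.PerL :=
  perL_ofSignRecipe₁₀ U M.toPerL h C d12 d34 (S := fun _ => True) (fun _ _ => trivial)
    ((A.pt _).toMeet₂ M.pull_comp M.pull_cup) hHR

end Assembly
end HodgeCM
end
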